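import Mathlib.RingTheory.AlgebraicIndependent.TranscendenceBasis
import Literature.NumberTheory.Transcendental.DiazGrid
import Literature.NumberTheory.Transcendental.DiazLadder
import Literature.NumberTheory.Transcendental.DiazMain
import Literature.NumberTheory.Transcendental.GelfondDiaz
import Literature.NumberTheory.Transcendental.GelfondSchneiderProofs
import Literature.NumberTheory.Transcendental.LiouvilleLinearForms
import Literature.NumberTheory.Transcendental.PeriodsWave0
import HarnessLib

/-!
# The Gelfond–Diaz ladder from Diaz's grid theorem (proof of LNM 1752, Ch. 14, Cor. 2.8)

Topic `Literature/NumberTheory/Transcendental` (trunk T-TRANSCEND). This file carries out, in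
Lean, the deduction of the named fact `Literature.NumberTheory.Transcendental.diaz_1989` (`DiazLadder.lean`;
Nesterenko–Philippon (eds.) 2001, Ch. 14, Corollary 2.8: `trdeg ℚ(α^β, …, α^{β^{d-1}}) ≥ [(d+1)/2]`)
from

* Diaz's main theorem on the `d × ℓ` grid, bound for `t₁` (named fact `Diaz1989_gridX`,
  `DiazGrid.lean`; loc. cit. Theorem 2.7), used for `d ≥ 3`, and
* the Gelfond–Schneider theorem (named fact `Literature.NumberTheory.Transcendental.gelfond_schneider`, `PeriodsWave0.lean`,
  discharged in the tree by `Literature.NumberTheory.Transcendental.gelfond_schneider_holds`, `GelfondSchneiderProofs.lean`,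
  from Baker's theorem), which is the case `d = 2` (there `[(d+1)/2] = 1`, i.e. `α^β` is
  transcendental; Theorem 2.7 needs `dℓ > ℓ + d`, which fails for `d = ℓ = 2`, so the printed
  one-line proof "take `ℓ = d`, `xᵢ = β^{i-1}`, `yⱼ = β^{j-1} log α`" covers `d ≥ 3` and the case
  `d = 2` is Gelfond–Schneider).

Main results: `diaz_1989_of_grid : Diaz1989_gridX → Literature.Periods.gelfond_schneider → diaz_1989`,
hence `diaz_1989_of_gridX : Diaz1989_gridX → diaz_1989` (Gelfond–Schneider being proved), and the
same for the duplicate vendoring `Literature.NumberTheory.Transcendental.Diaz1989` (`GelfondDiaz.lean`). What remains for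
`diaz_1989_holds` is exactly Diaz's grid theorem `Diaz1989_gridX` (LNM 1752, Ch. 14, Thm 2.7).

Ingredients proved here (all for `β ∈ ℂ` with `deg minpoly_ℚ β = d`, `e^l = α` algebraic, `l ≠ 0`):

* `technicalHypothesis_pow`, `technicalHypothesis_pow_mul`: the families `(β^i)_{i<d}` and
  `(β^i l)_{i<d}` satisfy (T.H.) — by Liouville's inequality (`LiouvilleLinearForms.lean`) and
  `TechnicalHypothesis.of_lowerBound`;
* `isIntegral_exp_pow_mul`: every `α^{β^m} = exp (β^m l)`, `m ≥ 0`, is algebraic over the ladder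
  field `F = ℚ(α^β, …, α^{β^{d-1}})` — the set `{z ; e^z algebraic over F}` is a `ℚ`-subspace of
  `ℂ` containing `l, βl, …, β^{d-1}l`, and `β^m ∈ span_ℚ(1, β, …, β^{d-1})`;
* `trdeg_gridField_le`: hence the field `K(x₁, …, x_d)` of Theorem 2.7 for the grid
  `xᵢ = β^{i-1}`, `yⱼ = β^{j-1} l` (generated by the `α^{β^{i+j-2}}` and the `β^{i-1}`) is algebraic
  over `F`, so its transcendence degree is at most `trdeg_ℚ F`;
* `[d(d+1)/(2d)] = [(d+1)/2]`.

## References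

* Yu. V. Nesterenko, P. Philippon (eds.), *Introduction to Algebraic Independence Theory*,
  LNM 1752, Springer 2001, Ch. 14 (M. Waldschmidt), Theorem 2.7, Corollary 2.8 and its proof
  (p. 249), end of §3.3 (p. 258: (T.H.) for `β^{i-1}`, `β^{j-1} log α` by Liouville's inequality).
* G. Diaz, *Grands degrés de transcendance pour des familles d'exponentielles*, J. Number Theory
  31 (1989), 1–23.
* A. O. Gelfond (1934), Th. Schneider (1934): the case `d = 2`.
-/

noncomputable section

open Finset IntermediateField Complex

namespace Literature.NumberTheory.Transcendental

/-! ### (T.H.) for powers of an algebraic number -/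

/-- The powers `1, β, …, β^{d-1}` of an algebraic number `β` of degree `d` satisfy the Technical
Hypothesis (Nesterenko–Philippon (eds.) 2001, Ch. 14, p. 258: "satisfied by Liouville's
inequality"). [cite: NesterenkoPhilippon2001, Ch. 14 §3.3 p. 258] -/
theorem technicalHypothesis_pow (β : ℂ) {d : ℕ} (hd : (minpoly ℚ β).natDegree = d) :
    TechnicalHypothesis fun i : Fin d => β ^ (i : ℕ) := by
  obtain ⟨c, hc, k, hb⟩ := exists_pos_le_sum_abs_pow_mul_norm_linearForm_pow β hd
  exact TechnicalHypothesis.of_lowerBound hc (k := k) fun h hh => by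
    simpa [Int.cast_abs] using hb h hh

/-- The numbers `l, βl, …, β^{d-1}l` (`β` algebraic of degree `d`, `l ≠ 0`; in the application
`l = log α`) satisfy the Technical Hypothesis (loc. cit., p. 258).
[cite: NesterenkoPhilippon2001, Ch. 14 §3.3 p. 258] -/
theorem technicalHypothesis_pow_mul (β : ℂ) {d : ℕ} (hd : (minpoly ℚ β).natDegree = d)
    {l : ℂ} (hl : l ≠ 0) : TechnicalHypothesis fun i : Fin d => β ^ (i : ℕ) * l := by
  obtain ⟨c, hc, k, hb⟩ := exists_pos_le_sum_abs_pow_mul_norm_linearForm_pow β hd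
  have hl' : 0 < ‖l‖ := norm_pos_iff.mpr hl
  refine TechnicalHypothesis.of_lowerBound (mul_pos hc hl') (k := k) fun h hh => ?_
  have e : ∑ i, (h i : ℂ) * (β ^ (i : ℕ) * l) = (∑ i, (h i : ℂ) * β ^ (i : ℕ)) * l := by
    rw [sum_mul]
    exact sum_congr rfl fun i _ => by ring
  rw [e, norm_mul, ← mul_assoc]
  have hb' : c ≤ (∑ i, (|h i| : ℝ)) ^ k * ‖∑ i, (h i : ℂ) * β ^ (i : ℕ)‖ := by
    simpa [Int.cast_abs] using hb h hh
  exact mul_le_mul_of_nonneg_right hb' hl'.le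

/-! ### Algebraicity of all `α^{β^m}` over the ladder field -/

/-- If `deg minpoly_ℚ β = d ≥ 1` then `β` is integral over `ℚ`. [folklore] -/
theorem isIntegral_of_natDegree_minpoly {β : ℂ} {d : ℕ} (hd : (minpoly ℚ β).natDegree = d)
    (h1 : 1 ≤ d) : IsIntegral ℚ β := by
  by_contra hn
  rw [minpoly.eq_zero hn, Polynomial.natDegree_zero] at hd
  omega

/-- **All `α^{β^m}` are algebraic over the ladder field.** Let `β` be algebraic of degree `d ≥ 1`,
`e^l = α` algebraic over `ℚ`, and `F = ℚ(e^{βl}, …, e^{β^{d-1}l})`. Then `e^{β^m l}` is algebraic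
(integral) over `F` for every `m ≥ 0`: the set of `z ∈ ℂ` with `e^z` algebraic over `F` is a
`ℚ`-subspace (closed under sums by `e^{z+w} = e^z e^w`, under `z ↦ qz` because
`(e^{qz})^{den q} = (e^z)^{num q}`), it contains `l, βl, …, β^{d-1}l`, and
`β^m ∈ span_ℚ(1, β, …, β^{d-1})`. [folklore] -/
theorem isIntegral_exp_pow_mul {α β l : ℂ} {d : ℕ} (hα : IsAlgebraic ℚ α)
    (hd : (minpoly ℚ β).natDegree = d) (h1 : 1 ≤ d) (hexp : Complex.exp l = α) (m : ℕ) :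
    IsIntegral (↥(IntermediateField.adjoin ℚ
      (Set.range fun k : Fin (d - 1) => Complex.exp (β ^ (k.val + 1) * l))))
      (Complex.exp (β ^ m * l)) := by
  set F := IntermediateField.adjoin ℚ
    (Set.range fun k : Fin (d - 1) => Complex.exp (β ^ (k.val + 1) * l)) with hF
  have hβ : IsIntegral ℚ β := isIntegral_of_natDegree_minpoly hd h1
  -- Integral powers of an `F`-algebraic exponential are `F`-algebraic.
  have hzpow : ∀ z : ℂ, IsIntegral F (Complex.exp z) → ∀ n : ℤ, IsIntegral F (Complex.exp z ^ n) := by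
    intro z hz n
    rcases Int.eq_nat_or_neg n with ⟨k, rfl | rfl⟩
    · simpa using hz.pow k
    · rw [zpow_neg, zpow_natCast]
      exact (hz.pow k).inv
  -- The `ℚ`-subspace `S = {z ; e^z algebraic over F}`.
  let S : Submodule ℚ ℂ :=
    { carrier := {z | IsIntegral F (Complex.exp z)}
      add_mem' := fun {a b} ha hb => by
        simp only [Set.mem_setOf_eq] at ha hb ⊢
        rw [Complex.exp_add]
        exact ha.mul hb
      zero_mem' := by
        simp only [Set.mem_setOf_eq, Complex.exp_zero]
        exact isIntegral_one
      smul_mem' := fun q z hz => by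
        simp only [Set.mem_setOf_eq] at hz ⊢
        refine IsIntegral.of_pow (Nat.pos_of_ne_zero q.den_nz) ?_
        have e : Complex.exp (q • z) ^ q.den = Complex.exp z ^ q.num := by
          rw [← Complex.exp_nat_mul, ← Complex.exp_int_mul, Rat.smul_def, ← mul_assoc]
          congr 2
          exact_mod_cast Rat.den_mul_eq_num q
        rw [e]
        exact hzpow z hz q.num }
  -- Its generators `β^i l`, `i < d`, lie in `S`.
  have hgen : ∀ i : ℕ, i < d → β ^ i * l ∈ S := by
    intro i hi
    show IsIntegral F (Complex.exp (β ^ i * l))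
    rcases Nat.eq_zero_or_pos i with rfl | hi0
    · -- `e^l = α` is algebraic over `ℚ`, hence over `F`.
      rw [pow_zero, one_mul, hexp]
      exact hα.isIntegral.tower_top
    · -- `e^{β^i l}` is one of the generators of `F`.
      have hmem : Complex.exp (β ^ i * l) ∈ F := by
        apply IntermediateField.subset_adjoin
        refine ⟨⟨i - 1, by omega⟩, ?_⟩
        simp only
        rw [Nat.sub_add_cancel hi0]
      exact isIntegral_algebraMap (R := F) (A := ℂ) (x := ⟨_, hmem⟩)
  -- `β^m ∈ span_ℚ (β^i)_{i<d}`, hence `β^m l ∈ span_ℚ (β^i l) ≤ S`.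
  have hm : β ^ m ∈ Submodule.span ℚ (Set.range fun i : Fin (minpoly ℚ β).natDegree => β ^ (i : ℕ)) :=
    hβ.mem_span_pow ⟨Polynomial.X ^ m, by simp⟩
  have hml := Submodule.apply_mem_span_image_of_mem_span (LinearMap.mulRight ℚ l) hm
  have hle : Submodule.span ℚ ((LinearMap.mulRight ℚ l) ''
      Set.range fun i : Fin (minpoly ℚ β).natDegree => β ^ (i : ℕ)) ≤ S := by
    refine Submodule.span_le.mpr ?_
    rintro _ ⟨_, ⟨i, rfl⟩, rfl⟩
    simpa using hgen i (hd ▸ i.isLt)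
  simpa using (show IsIntegral F (Complex.exp ((LinearMap.mulRight ℚ l) (β ^ m))) from hle hml)

/-! ### Transcendence degree bookkeeping -/

/-- For the grid `xᵢ = β^{i}`, `yⱼ = β^{j} l` (`0 ≤ i, j < d`), the field generated over `ℚ` by
`K = ℚ(e^{xᵢyⱼ})` and the `xᵢ` has transcendence degree at most that of the ladder field
`ℚ(e^{βl}, …, e^{β^{d-1}l})`, because it is contained in an algebraic extension of the latter
(`isIntegral_exp_pow_mul` and `β` algebraic). [folklore] -/
theorem trdeg_gridField_le {α β l : ℂ} {d : ℕ} (hα : IsAlgebraic ℚ α)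
    (hd : (minpoly ℚ β).natDegree = d) (h1 : 1 ≤ d) (hexp : Complex.exp l = α)
    (K : IntermediateField ℚ ℂ)
    (hK : K ≤ IntermediateField.adjoin ℚ (Set.range fun p : Fin d × Fin d =>
      Complex.exp (β ^ (p.1 : ℕ) * (β ^ (p.2 : ℕ) * l)))) :
    Algebra.trdeg ℚ ↥(IntermediateField.adjoin ℚ ((K : Set ℂ) ∪ Set.range fun i : Fin d => β ^ (i : ℕ)))
      ≤ Algebra.trdeg ℚ ↥(IntermediateField.adjoin ℚ
          (Set.range fun k : Fin (d - 1) => Complex.exp (β ^ (k.val + 1) * l))) := by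
  set F := IntermediateField.adjoin ℚ
    (Set.range fun k : Fin (d - 1) => Complex.exp (β ^ (k.val + 1) * l)) with hF
  set e : Fin d × Fin d → ℂ := fun p => Complex.exp (β ^ (p.1 : ℕ) * (β ^ (p.2 : ℕ) * l)) with he
  set x : Fin d → ℂ := fun i => β ^ (i : ℕ) with hx
  have hβ : IsIntegral ℚ β := isIntegral_of_natDegree_minpoly hd h1
  -- All generators are integral over `F`.
  have hT : ∀ z ∈ Set.range e ∪ Set.range x, IsIntegral F z := by
    rintro z (⟨p, rfl⟩ | ⟨i, rfl⟩)
    · have : e p = Complex.exp (β ^ ((p.1 : ℕ) + (p.2 : ℕ)) * l) := by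
        simp only [he, pow_add, mul_assoc]
      rw [this]
      exact isIntegral_exp_pow_mul hα hd h1 hexp _
    · exact (hβ.pow _).tower_top
  -- The algebraic extension `E = F(e, x)` of `F`.
  set E : IntermediateField F ℂ := IntermediateField.adjoin F (Set.range e ∪ Set.range x) with hE
  haveI hEalg : Algebra.IsAlgebraic F E := IntermediateField.isAlgebraic_adjoin hT
  have htE : Algebra.trdeg ℚ E = Algebra.trdeg ℚ F := by
    have := trdeg_add_eq (R := ℚ) (S := F) (A := E)
    rw [trdeg_eq_zero (R := F) (A := E), add_zero] at this
    exact this.symm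
  -- `K(x) ⊆ E` as subsets of `ℂ`.
  have hsub : ((IntermediateField.adjoin ℚ ((K : Set ℂ) ∪ Set.range x) : IntermediateField ℚ ℂ) :
      Set ℂ) ⊆ (E : Set ℂ) := by
    have hle : IntermediateField.adjoin ℚ ((K : Set ℂ) ∪ Set.range x) ≤ E.restrictScalars ℚ := by
      refine IntermediateField.adjoin_le_iff.mpr (Set.union_subset ?_ ?_)
      · intro z hz
        have hz' : z ∈ IntermediateField.adjoin ℚ (Set.range e) := hK hz
        have hle' : IntermediateField.adjoin ℚ (Set.range e) ≤ E.restrictScalars ℚ :=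
          IntermediateField.adjoin_le_iff.mpr fun w hw =>
            IntermediateField.subset_adjoin F _ (Set.mem_union_left _ hw)
        exact hle' hz'
      · intro z hz
        exact IntermediateField.subset_adjoin F _ (Set.mem_union_right _ hz)
    intro z hz
    exact hle hz
  let f : ↥(IntermediateField.adjoin ℚ ((K : Set ℂ) ∪ Set.range x)) →ₐ[ℚ] E :=
    { toFun := fun z => ⟨z.1, hsub z.2⟩
      map_one' := rfl
      map_mul' := fun _ _ => rfl
      map_zero' := rfl
      map_add' := fun _ _ => rfl
      commutes' := fun _ => rfl }
  calc Algebra.trdeg ℚ ↥(IntermediateField.adjoin ℚ ((K : Set ℂ) ∪ Set.range x))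
      ≤ Algebra.trdeg ℚ E := trdeg_le_of_injective f f.toRingHom.injective
    _ = Algebra.trdeg ℚ F := htE

/-! ### The case `d = 2`: Gelfond–Schneider -/

/-- For `β` of degree `2`, `e^l = α` algebraic, `l ≠ 0`, Gelfond–Schneider gives
`trdeg ℚ(α^β) ≥ 1 = [(2+1)/2]`. [cite: Gelfond1934] -/
theorem diaz_ladder_two (hGS : Literature.NumberTheory.Transcendental.gelfond_schneider) {α β l : ℂ}
    (hα : IsAlgebraic ℚ α) (hd : (minpoly ℚ β).natDegree = 2) (hexp : Complex.exp l = α)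
    (hl : l ≠ 0) :
    (((2 + 1) / 2 : ℕ) : Cardinal) ≤ Algebra.trdeg ℚ
      ↥(IntermediateField.adjoin ℚ (Set.range fun k : Fin (2 - 1) => Complex.exp (β ^ (k.val + 1) * l))) := by
  have hβ : IsIntegral ℚ β := isIntegral_of_natDegree_minpoly hd (by norm_num)
  have hβq : β ∉ Set.range ((↑) : ℚ → ℂ) := by
    rintro ⟨q, rfl⟩
    rw [show ((q : ℂ)) = algebraMap ℚ ℂ q from rfl, minpoly.eq_X_sub_C,
      Polynomial.natDegree_X_sub_C] at hd
    omega
  have ht : Transcendental ℚ (Complex.exp (β * l)) := hGS hα hβ.isAlgebraic hβq hexp hl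
  set K₀ := IntermediateField.adjoin ℚ
    (Set.range fun k : Fin (2 - 1) => Complex.exp (β ^ (k.val + 1) * l)) with hK₀
  have hmem : Complex.exp (β * l) ∈ K₀ := by
    apply IntermediateField.subset_adjoin
    exact ⟨⟨0, by norm_num⟩, by simp⟩
  have ht' : Transcendental ℚ (⟨_, hmem⟩ : K₀) := by
    intro halg
    exact ht (IntermediateField.isAlgebraic_iff.mp halg)
  haveI : Algebra.Transcendental ℚ K₀ := ⟨⟨_, ht'⟩⟩
  have h1 : (1 : Cardinal) ≤ Algebra.trdeg ℚ K₀ := Cardinal.one_le_iff_pos.mpr (trdeg_pos ℚ K₀)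
  simpa using h1

/-! ### Assembly -/

/-- `[d(d+1)/(2d)] = [(d+1)/2]` for `d ≥ 1`. [folklore] -/
theorem grid_exponent_eq (d : ℕ) (hd : 0 < d) : d * (d + 1) / (d + d) = (d + 1) / 2 := by
  rw [← two_mul, mul_comm 2 d]
  exact Nat.mul_div_mul_left _ _ hd

/-- **The Gelfond–Diaz ladder from the grid theorem** (proof of Nesterenko–Philippon (eds.) 2001,
Ch. 14, Corollary 2.8, p. 249): Diaz's Theorem 2.7 (bound for `t₁`) together with the
Gelfond–Schneider theorem (case `d = 2`) imply `diaz_1989`: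
`trdeg ℚ(α^β, …, α^{β^{d-1}}) ≥ [(d+1)/2]`. For `d ≥ 3` take `ℓ = d`, `xᵢ = β^{i-1}`,
`yⱼ = β^{j-1} log α` (both families `ℚ`-linearly independent with (T.H.) by Liouville), so that
`e^{xᵢyⱼ} = α^{β^{i+j-2}}` and `K(x₁, …, x_d)` is algebraic over the ladder field.
[cite: NesterenkoPhilippon2001, Ch. 14 Cor. 2.8 (proof), p. 249] -/
theorem diaz_1989_of_grid (h27 : Diaz1989_gridX) (hGS : Literature.NumberTheory.Transcendental.gelfond_schneider) :
    diaz_1989 := by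
  intro α β l d hα hd h2 hexp hl
  rcases h2.eq_or_lt with rfl | h3
  · exact diaz_ladder_two hGS hα hd hexp hl
  -- `d ≥ 3`: apply Theorem 2.7 with `ℓ = d`, `xᵢ = β^i`, `yⱼ = β^j l` (`0 ≤ i, j < d`).
  have h1 : 1 ≤ d := by omega
  set x : Fin d → ℂ := fun i => β ^ (i : ℕ) with hx
  set y : Fin d → ℂ := fun j => β ^ (j : ℕ) * l with hy
  have hxli : LinearIndependent ℚ x := by
    have := linearIndependent_pow (K := ℚ) β
    rwa [hd] at this
  have hyli : LinearIndependent ℚ y :=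
    hxli.map' (LinearMap.mulRight ℚ l) (LinearMap.ker_eq_bot.mpr (mul_left_injective₀ hl))
  have hxTH : TechnicalHypothesis x := technicalHypothesis_pow β hd
  have hyTH : TechnicalHypothesis y := technicalHypothesis_pow_mul β hd hl
  have hlt : d + d < d * d := by nlinarith
  set K := IntermediateField.adjoin ℚ (Set.range fun p : Fin d × Fin d =>
    Complex.exp (β ^ (p.1 : ℕ) * (β ^ (p.2 : ℕ) * l))) with hK
  have hKmem : ∀ i j, Complex.exp (x i * y j) ∈ K := fun i j =>
    IntermediateField.subset_adjoin ℚ _ ⟨(i, j), rfl⟩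
  have hmain := h27 d d x y hxli hxTH hyli hyTH hlt K hKmem
  rw [grid_exponent_eq d (by omega)] at hmain
  exact hmain.trans (trdeg_gridField_le hα hd h1 hexp K le_rfl)

/-- **The Gelfond–Diaz ladder from the grid theorem alone**: since Gelfond–Schneider is proved in
the tree (`Literature.NumberTheory.Transcendental.gelfond_schneider_holds`), Diaz's Theorem 2.7 (bound for `t₁`) implies
`diaz_1989`. [cite: NesterenkoPhilippon2001, Ch. 14 Cor. 2.8 (proof), p. 249] -/
theorem diaz_1989_of_gridX (h27 : Diaz1989_gridX) : diaz_1989 :=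
  diaz_1989_of_grid h27 Literature.NumberTheory.Transcendental.gelfond_schneider_holds

/-- The same reduction for the duplicate vendoring `Literature.NumberTheory.Transcendental.Diaz1989` (`GelfondDiaz.lean`),
whose statement is `diaz_1989` with the redundant extra hypothesis `IsAlgebraic ℚ b`.
[cite: NesterenkoPhilippon2001, Ch. 14 Cor. 2.8, p. 249] -/
theorem periods_Diaz1989_of_diaz_1989 (h : diaz_1989) : Literature.NumberTheory.Transcendental.Diaz1989 :=
  fun ha _hb hl hl0 d hd h2 => h _ _ _ d ha hd h2 hl hl0

/-- Conversely `Literature.NumberTheory.Transcendental.Diaz1989` implies `diaz_1989`: its extra hypothesis `IsAlgebraic ℚ b`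
follows from `deg (minpoly ℚ b) = d ≥ 2`. So the two vendored ladder facts are equivalent
(`diaz_1989_iff_periods_Diaz1989`). [folklore] -/
theorem diaz_1989_of_periods_Diaz1989 (h : Literature.NumberTheory.Transcendental.Diaz1989) : diaz_1989 :=
  fun _α _β _l d hα hd h2 hexp hl =>
    h hα (isIntegral_of_natDegree_minpoly hd (by omega)).isAlgebraic hexp hl d hd h2

/-- The two vendored forms of Diaz's ladder theorem, `Literature.NumberTheory.Transcendental.diaz_1989`
(`DiazLadder.lean`) and `Literature.NumberTheory.Transcendental.Diaz1989` (`GelfondDiaz.lean`), are equivalent. [folklore] -/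
theorem diaz_1989_iff_periods_Diaz1989 : diaz_1989 ↔ Literature.NumberTheory.Transcendental.Diaz1989 :=
  ⟨periods_Diaz1989_of_diaz_1989, diaz_1989_of_periods_Diaz1989⟩

/-- Hence `Literature.NumberTheory.Transcendental.Diaz1989` also follows from the grid theorem and Gelfond–Schneider.
[cite: NesterenkoPhilippon2001, Ch. 14 Cor. 2.8, p. 249] -/
theorem periods_Diaz1989_of_grid (h27 : Diaz1989_gridX) (hGS : Literature.NumberTheory.Transcendental.gelfond_schneider) :
    Literature.NumberTheory.Transcendental.Diaz1989 :=
  periods_Diaz1989_of_diaz_1989 (diaz_1989_of_grid h27 hGS)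

/-- Hence `Literature.NumberTheory.Transcendental.Diaz1989` follows from the grid theorem alone.
[cite: NesterenkoPhilippon2001, Ch. 14 Cor. 2.8, p. 249] -/
theorem periods_Diaz1989_of_gridX (h27 : Diaz1989_gridX) : Literature.NumberTheory.Transcendental.Diaz1989 :=
  periods_Diaz1989_of_grid h27 Literature.NumberTheory.Transcendental.gelfond_schneider_holds

/-! ### v2: from the primary statements (Diaz 1989, Théorème 1, Corollaire 1) -/

/-- **The Gelfond–Diaz ladder from Diaz's Théorème 1** (the primary statement, `DiazMain.lean`):
`Diaz1989_thm1 → diaz_1989`, through `Diaz1989_gridX_of_thm1` (T.H. ⇒ (HT1)) and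
`diaz_1989_of_gridX` (Cor. 2.8 of LNM 1752 Ch. 14, with Gelfond–Schneider for `d = 2`).
[cite: Diaz1989, Corollaire 2, p. 3 (deduced from Théorème 1)] -/
theorem diaz_1989_of_thm1 (h : Diaz1989_thm1) : diaz_1989 :=
  diaz_1989_of_gridX (Diaz1989_gridX_of_thm1 h)

/-- The ladder from Laurent's transcription ii) as well (for completeness).
[cite: Laurent1991, §3.1 Corollaire, p. 213] -/
theorem diaz_1989_of_main (h : Diaz1989_main_ii) : diaz_1989 :=
  diaz_1989_of_gridX (Diaz1989_gridX_of_main h)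

/-- **All `e^{β^m l}` are algebraic over `ℚ(e^{l}, e^{βl}, …, e^{β^{d-1}l})`** for `β` algebraic of
degree `d ≥ 1` and any `l ∈ ℂ` (no algebraicity of `e^l` needed: it is one of the generators).
Same proof as `isIntegral_exp_pow_mul`. [folklore] -/
theorem isIntegral_exp_pow_mul' {β l : ℂ} {d : ℕ} (hd : (minpoly ℚ β).natDegree = d) (h1 : 1 ≤ d)
    (m : ℕ) :
    IsIntegral (↥(IntermediateField.adjoin ℚ (Set.range fun k : Fin d => Complex.exp (β ^ (k : ℕ) * l))))
      (Complex.exp (β ^ m * l)) := by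
  set F := IntermediateField.adjoin ℚ (Set.range fun k : Fin d => Complex.exp (β ^ (k : ℕ) * l))
    with hF
  have hβ : IsIntegral ℚ β := isIntegral_of_natDegree_minpoly hd h1
  have hzpow : ∀ z : ℂ, IsIntegral F (Complex.exp z) → ∀ n : ℤ, IsIntegral F (Complex.exp z ^ n) := by
    intro z hz n
    rcases Int.eq_nat_or_neg n with ⟨k, rfl | rfl⟩
    · simpa using hz.pow k
    · rw [zpow_neg, zpow_natCast]
      exact (hz.pow k).inv
  let S : Submodule ℚ ℂ :=
    { carrier := {z | IsIntegral F (Complex.exp z)}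
      add_mem' := fun {a b} ha hb => by
        simp only [Set.mem_setOf_eq] at ha hb ⊢
        rw [Complex.exp_add]
        exact ha.mul hb
      zero_mem' := by
        simp only [Set.mem_setOf_eq, Complex.exp_zero]
        exact isIntegral_one
      smul_mem' := fun q z hz => by
        simp only [Set.mem_setOf_eq] at hz ⊢
        refine IsIntegral.of_pow (Nat.pos_of_ne_zero q.den_nz) ?_
        have e : Complex.exp (q • z) ^ q.den = Complex.exp z ^ q.num := by
          rw [← Complex.exp_nat_mul, ← Complex.exp_int_mul, Rat.smul_def, ← mul_assoc]
          congr 2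
          exact_mod_cast Rat.den_mul_eq_num q
        rw [e]
        exact hzpow z hz q.num }
  have hgen : ∀ i : ℕ, i < d → β ^ i * l ∈ S := by
    intro i hi
    show IsIntegral F (Complex.exp (β ^ i * l))
    have hmem : Complex.exp (β ^ i * l) ∈ F :=
      IntermediateField.subset_adjoin ℚ _ ⟨⟨i, hi⟩, rfl⟩
    exact isIntegral_algebraMap (R := F) (A := ℂ) (x := ⟨_, hmem⟩)
  have hm : β ^ m ∈ Submodule.span ℚ (Set.range fun i : Fin (minpoly ℚ β).natDegree => β ^ (i : ℕ)) :=
    hβ.mem_span_pow ⟨Polynomial.X ^ m, by simp⟩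
  have hml := Submodule.apply_mem_span_image_of_mem_span (LinearMap.mulRight ℚ l) hm
  have hle : Submodule.span ℚ ((LinearMap.mulRight ℚ l) ''
      Set.range fun i : Fin (minpoly ℚ β).natDegree => β ^ (i : ℕ)) ≤ S := by
    refine Submodule.span_le.mpr ?_
    rintro _ ⟨_, ⟨i, rfl⟩, rfl⟩
    simpa using hgen i (hd ▸ i.isLt)
  simpa using (show IsIntegral F (Complex.exp ((LinearMap.mulRight ℚ l) (β ^ m))) from hle hml)

/-- For the grid `xᵢ = β^i`, `yⱼ = β^j l` and any `l`, the field `K(x)` (`K = ℚ(e^{xᵢyⱼ})`) has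
transcendence degree at most that of `ℚ(e^l, e^{βl}, …, e^{β^{d-1}l})`. [folklore] -/
theorem trdeg_gridField_le' {β l : ℂ} {d : ℕ} (hd : (minpoly ℚ β).natDegree = d) (h1 : 1 ≤ d)
    (K : IntermediateField ℚ ℂ)
    (hK : K ≤ IntermediateField.adjoin ℚ (Set.range fun p : Fin d × Fin d =>
      Complex.exp (β ^ (p.1 : ℕ) * (β ^ (p.2 : ℕ) * l)))) :
    Algebra.trdeg ℚ ↥(IntermediateField.adjoin ℚ ((K : Set ℂ) ∪ Set.range fun i : Fin d => β ^ (i : ℕ)))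
      ≤ Algebra.trdeg ℚ ↥(IntermediateField.adjoin ℚ
          (Set.range fun k : Fin d => Complex.exp (β ^ (k : ℕ) * l))) := by
  set F := IntermediateField.adjoin ℚ (Set.range fun k : Fin d => Complex.exp (β ^ (k : ℕ) * l))
    with hF
  set e : Fin d × Fin d → ℂ := fun p => Complex.exp (β ^ (p.1 : ℕ) * (β ^ (p.2 : ℕ) * l)) with he
  set x : Fin d → ℂ := fun i => β ^ (i : ℕ) with hx
  have hβ : IsIntegral ℚ β := isIntegral_of_natDegree_minpoly hd h1
  have hT : ∀ z ∈ Set.range e ∪ Set.range x, IsIntegral F z := by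
    rintro z (⟨p, rfl⟩ | ⟨i, rfl⟩)
    · have : e p = Complex.exp (β ^ ((p.1 : ℕ) + (p.2 : ℕ)) * l) := by
        simp only [he, pow_add, mul_assoc]
      rw [this]
      exact isIntegral_exp_pow_mul' hd h1 _
    · exact (hβ.pow _).tower_top
  set E : IntermediateField F ℂ := IntermediateField.adjoin F (Set.range e ∪ Set.range x) with hE
  haveI hEalg : Algebra.IsAlgebraic F E := IntermediateField.isAlgebraic_adjoin hT
  have htE : Algebra.trdeg ℚ E = Algebra.trdeg ℚ F := by
    have := trdeg_add_eq (R := ℚ) (S := F) (A := E)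
    rw [trdeg_eq_zero (R := F) (A := E), add_zero] at this
    exact this.symm
  have hsub : ((IntermediateField.adjoin ℚ ((K : Set ℂ) ∪ Set.range x) : IntermediateField ℚ ℂ) :
      Set ℂ) ⊆ (E : Set ℂ) := by
    have hle : IntermediateField.adjoin ℚ ((K : Set ℂ) ∪ Set.range x) ≤ E.restrictScalars ℚ := by
      refine IntermediateField.adjoin_le_iff.mpr (Set.union_subset ?_ ?_)
      · intro z hz
        have hz' : z ∈ IntermediateField.adjoin ℚ (Set.range e) := hK hz
        have hle' : IntermediateField.adjoin ℚ (Set.range e) ≤ E.restrictScalars ℚ :=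
          IntermediateField.adjoin_le_iff.mpr fun w hw =>
            IntermediateField.subset_adjoin F _ (Set.mem_union_left _ hw)
        exact hle' hz'
      · intro z hz
        exact IntermediateField.subset_adjoin F _ (Set.mem_union_right _ hz)
    intro z hz
    exact hle hz
  let f : ↥(IntermediateField.adjoin ℚ ((K : Set ℂ) ∪ Set.range x)) →ₐ[ℚ] E :=
    { toFun := fun z => ⟨z.1, hsub z.2⟩
      map_one' := rfl
      map_mul' := fun _ _ => rfl
      map_zero' := rfl
      map_add' := fun _ _ => rfl
      commutes' := fun _ => rfl }
  calc Algebra.trdeg ℚ ↥(IntermediateField.adjoin ℚ ((K : Set ℂ) ∪ Set.range x))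
      ≤ Algebra.trdeg ℚ E := trdeg_le_of_injective f f.toRingHom.injective
    _ = Algebra.trdeg ℚ F := htE

/-- **Diaz 1989, Corollaire 1 from Théorème 1** (p. 3: an arbitrary `a = e^l ≠ 0` with `l ≠ 0`):
for `d ≥ 3` apply `Diaz1989_gridX_of_thm1` with `ℓ = d`, `xᵢ = β^i`, `yⱼ = β^j l`; `K(x)` is
algebraic over `ℚ(e^l, e^{βl}, …, e^{β^{d-1}l})` (`trdeg_gridField_le'`). For `d = 2` the bound
`[(2+1)/2] = 1` is the transcendence of one of `e^l, e^{βl}`: if both were algebraic,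
Gelfond–Schneider (with `α = e^l`) would be contradicted.
[cite: Diaz1989, Corollaire 1, p. 3] -/
theorem Diaz1989_cor1_of_thm1 (h : Diaz1989_thm1) : Diaz1989_cor1 := by
  intro a β l d hd h2 hexp hl
  have h1 : 1 ≤ d := by omega
  set F := IntermediateField.adjoin ℚ (Set.range fun k : Fin d => Complex.exp (β ^ (k : ℕ) * l))
    with hF
  rcases h2.eq_or_lt with rfl | h3
  · -- `d = 2`: one of `e^l`, `e^{βl}` is transcendental.
    have hβ : IsIntegral ℚ β := isIntegral_of_natDegree_minpoly hd (by norm_num)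
    have hβq : β ∉ Set.range ((↑) : ℚ → ℂ) := by
      rintro ⟨q, rfl⟩
      rw [show ((q : ℂ)) = algebraMap ℚ ℂ q from rfl, minpoly.eq_X_sub_C,
        Polynomial.natDegree_X_sub_C] at hd
      omega
    have hmem0 : Complex.exp l ∈ F := by
      refine IntermediateField.subset_adjoin ℚ _ ⟨⟨0, by norm_num⟩, ?_⟩
      simp
    have hmem1 : Complex.exp (β * l) ∈ F := by
      refine IntermediateField.subset_adjoin ℚ _ ⟨⟨1, by norm_num⟩, ?_⟩
      simp
    -- If `F` were algebraic, Gelfond–Schneider fails.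
    have htr : Algebra.Transcendental ℚ F := by
      rw [Algebra.transcendental_iff_not_isAlgebraic]
      intro halg
      have ha : IsAlgebraic ℚ (Complex.exp l) :=
        IntermediateField.isAlgebraic_iff.mp (halg.isAlgebraic ⟨_, hmem0⟩)
      have hb : IsAlgebraic ℚ (⟨_, hmem1⟩ : F) := halg.isAlgebraic _
      have ht : Transcendental ℚ (Complex.exp (β * l)) :=
        Literature.NumberTheory.Transcendental.gelfond_schneider_holds ha hβ.isAlgebraic hβq rfl hl
      exact ht (IntermediateField.isAlgebraic_iff.mp hb)
    haveI := htr
    have h1' : (1 : Cardinal) ≤ Algebra.trdeg ℚ F := Cardinal.one_le_iff_pos.mpr (trdeg_pos ℚ F)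
    simpa using h1'
  -- `d ≥ 3`.
  set x : Fin d → ℂ := fun i => β ^ (i : ℕ) with hx
  set y : Fin d → ℂ := fun j => β ^ (j : ℕ) * l with hy
  have hxli : LinearIndependent ℚ x := by
    have := linearIndependent_pow (K := ℚ) β
    rwa [hd] at this
  have hyli : LinearIndependent ℚ y :=
    hxli.map' (LinearMap.mulRight ℚ l) (LinearMap.ker_eq_bot.mpr (mul_left_injective₀ hl))
  have hxTH : TechnicalHypothesis x := technicalHypothesis_pow β hd
  have hyTH : TechnicalHypothesis y := technicalHypothesis_pow_mul β hd hl
  have hlt : d + d < d * d := by nlinarith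
  set K := IntermediateField.adjoin ℚ (Set.range fun p : Fin d × Fin d =>
    Complex.exp (β ^ (p.1 : ℕ) * (β ^ (p.2 : ℕ) * l))) with hK
  have hKmem : ∀ i j, Complex.exp (x i * y j) ∈ K := fun i j =>
    IntermediateField.subset_adjoin ℚ _ ⟨(i, j), rfl⟩
  have hmain := Diaz1989_gridX_of_thm1 h d d x y hxli hxTH hyli hyTH hlt K hKmem
  rw [grid_exponent_eq d (by omega)] at hmain
  exact hmain.trans (trdeg_gridField_le' hd h1 K le_rfl)

/-- **Corollaire 2 from Corollaire 1**: for algebraic `α = e^l`, `ℚ(α, ladder)` is algebraic over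
`ℚ(ladder)`, so the two fields have the same transcendence degree. [cite: Diaz1989, Corollaire 2, p. 3] -/
theorem diaz_1989_of_cor1 (h : Diaz1989_cor1) : diaz_1989 := by
  intro α β l d hα hd h2 hexp hl
  have h1 : 1 ≤ d := by omega
  have hc := h α β l d hd h2 hexp hl
  -- `ℚ(e^{β^k l} ; k < d) ≤ K(x)`-type comparison: it is contained in an algebraic extension of the
  -- ladder field `ℚ(e^{β^{k+1} l} ; k < d-1)`.
  refine hc.trans ?_
  set F := IntermediateField.adjoin ℚ
    (Set.range fun k : Fin (d - 1) => Complex.exp (β ^ (k.val + 1) * l)) with hF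
  have hT : ∀ z ∈ Set.range (fun k : Fin d => Complex.exp (β ^ (k : ℕ) * l)), IsIntegral F z := by
    rintro z ⟨k, rfl⟩
    exact isIntegral_exp_pow_mul hα hd h1 hexp _
  set E : IntermediateField F ℂ :=
    IntermediateField.adjoin F (Set.range fun k : Fin d => Complex.exp (β ^ (k : ℕ) * l)) with hE
  haveI hEalg : Algebra.IsAlgebraic F E := IntermediateField.isAlgebraic_adjoin hT
  have htE : Algebra.trdeg ℚ E = Algebra.trdeg ℚ F := by
    have := trdeg_add_eq (R := ℚ) (S := F) (A := E)
    rw [trdeg_eq_zero (R := F) (A := E), add_zero] at this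
    exact this.symm
  have hsub : ((IntermediateField.adjoin ℚ (Set.range fun k : Fin d => Complex.exp (β ^ (k : ℕ) * l)) :
      IntermediateField ℚ ℂ) : Set ℂ) ⊆ (E : Set ℂ) := by
    have hle : IntermediateField.adjoin ℚ (Set.range fun k : Fin d => Complex.exp (β ^ (k : ℕ) * l))
        ≤ E.restrictScalars ℚ :=
      IntermediateField.adjoin_le_iff.mpr fun w hw => IntermediateField.subset_adjoin F _ hw
    intro z hz
    exact hle hz
  let f : ↥(IntermediateField.adjoin ℚ (Set.range fun k : Fin d => Complex.exp (β ^ (k : ℕ) * l)))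
      →ₐ[ℚ] E :=
    { toFun := fun z => ⟨z.1, hsub z.2⟩
      map_one' := rfl
      map_mul' := fun _ _ => rfl
      map_zero' := rfl
      map_add' := fun _ _ => rfl
      commutes' := fun _ => rfl }
  calc Algebra.trdeg ℚ ↥(IntermediateField.adjoin ℚ
          (Set.range fun k : Fin d => Complex.exp (β ^ (k : ℕ) * l)))
      ≤ Algebra.trdeg ℚ E := trdeg_le_of_injective f f.toRingHom.injective
    _ = Algebra.trdeg ℚ F := htE

end Literature.NumberTheory.Transcendental


end
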